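/-
Copyright (c) 2026 the pub-hodgecm-mathlib formalisation cell (harness21).  Prover seat hodgecm-mathlib-K2E1-p10 (g2), Track B ∕ K2-LIT (build stream 29),
h413 = `stmt-HodgeConjecture-24833`, route of record `HCCMUnconditional`, campaign «EIS-R7-BL-SPH-2»; dealer K2E1-plan (g6) deal (76) 2026-09-04T10:29:23Z
(the `N = 2` twin of ★ p859380 `K2E1SphericalEisensteinStructuralDataCMThree`, feeding the ABSOLUTE EDITION `sphericalEisenstein_meromorphic_cm_two_abs`).
-/
import Summits.HodgeConjecture.HodgeConjecture.Theorems.K2E1SphericalEisensteinStructuralDataCMThree   -- ★ p859380 (this seat): every-rank §1 `exists_coveringWeight_unfoldedMeasure`, `sFinite_of_unfolding`; brings ★ `hdis'`∕`hright` engines, ★ `map_conj_toAdelic_eq_self_two`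
import Literature.NumberTheory.Automorphic.UnitaryGroupLineUnipotentTwo                               -- ★ `N(𝔸) ≅ 𝔸_E⁻` at `N = 2`: Tate's transported domain, `isMulRightInvariant_of_isMulLeftInvariant_two`
import HarnessLib

/-!
# h413 ∕ Track B «K2-LIT», campaign «EIS-R7-BL-SPH-2» — helper `K2E1SphericalEisensteinStructuralDataCMTwo`: THE STRUCTURAL LETTERS OF THE `U(1,1)` CLOSER ARE INHABITED
# (Haar measure and Tate's fundamental domain of the abelian radical `N(𝔸) ≅ 𝔸_L⁻`, covering weight `β` and unfolded measure `μZ` on `Z = B(F)∖G(𝔸)`, unimodularity of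
# `U(J₂)(𝔸)`), AND THE DISINTEGRATION LETTER `hdis'` IS A THEOREM AT `N = 2` — the `N = 2` twin of ★ `K2E1SphericalEisensteinStructuralDataCMThree`

Cell `pub/hodgecm-mathlib`, crux h413 = `stmt-HodgeConjecture-24833`, route of record `HCCMUnconditional`; chair K2-lead (g1), dealer K2E1-plan (g6) deal (76) 2026-09-04T10:29:23Z:
«`K2E1SphericalEisensteinStructuralDataCMTwo.lean` (N = 2 twins: `exists_unipotent_haar_fundamentalDomain_cm_two`, `hdis'₂`∕`hright₂` prints,
`exists_haar_coveringWeight_unfoldedMeasure_cm_two`), THEN the two ABSOLUTE EDITIONS `K2E1SphericalEisensteinMeromorphicAbsoluteCM`».  The closer ★ p859271∕p859352∕ED. 3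
`K2E1SphericalEisensteinMeromorphicU2` keeps the structural binders `(νG) (ν) {𝓕} (h𝓕N h𝓕c h𝓕₀) (hβ) (hμZ)`; its conclusion mentions none of them, so the absolute edition
`sphericalEisenstein_meromorphic_cm_two_abs (L) (μ) (φ₀)` obtains them from THIS file.  THEOREMS ONLY (no `def`, no `instance`, no notation, no `sorry`); lane `--supports
stmt-HodgeConjecture-24833 --as helper` (count-neutral).  Closes no socket.

* §1 (`U(1,1)_{L∕L⁺}`, the radical): **`exists_unipotent_haar_fundamentalDomain_cm_two`** — `∃ ν 𝓕`, `ν` a Haar measure of `N(𝔸)` right- and inversion-invariant (`N(𝔸) ≅ 𝔸_L⁻` is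
  abelian, ★ `isMulRightInvariant_of_isMulLeftInvariant_two`, ★ `isInvInvariant_of_isMulRightInvariant`), `𝓕 = n(θ 𝓕⁻)` Tate's transported domain (★
  `isFundamentalDomain_image_traceZeroFundamentalDomain_two`) with compact closure (★ `exists_isCompact_image_traceZeroFundamentalDomain_subset_two`) and `0 < ν 𝓕 < ∞`.
* §2 (`U(1,1)_{L∕L⁺}`, `G`-side): `isMulRightInvariant_of_isHaarMeasure_cm_two`, `isInvInvariant_of_isHaarMeasure_cm_two`, **`exists_haar_coveringWeight_unfoldedMeasure_cm_two`**.
* §3 (`U(1,1)_{L∕L⁺}`): **`integral_zFun_borelConstantTerm_eq_cm_two`** = the closer's `hdis'` (★ p859271 :172) for every `k`, `a` (★ every-rank `integral_zFun_borelConstantTerm_eq_of_unfolding`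
  ∘ ★ `map_conj_toAdelic_eq_self_two`), and `integral_zFun_borelConstantTerm_eq_of_isCompact_closure_cm_two`.
* §4 (`U(1,1)_{L∕L⁺}`): **`measurePreserving_rightShift_cm_two`** (★ `hright`, unimodularity discharged).

HONEST LABEL: HC_CM is proved only modulo the 7 printed citations (2 remaining named inputs: hLiu418 = `stmt-HodgeConjecture-24832`, h413 = `stmt-HodgeConjecture-24833`) until rung 0
closes; this file asserts no named fact and closes no socket.
References: [BernsteinLapid2019] J. Bernstein, E. Lapid, *On the meromorphic continuation of Eisenstein series*, arXiv:1911.02342 (JAMS 37 (2024)), §4 Claim 4 (p. 10);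
[CasselsFrohlichANT1967] J. Tate, *Fourier analysis in number fields and Hecke's zeta-functions*, in Cassels–Fröhlich (1967), Ch. XV Thm. 4.1.3; [Rogawski1990] J. D. Rogawski,
*Automorphic Representations of Unitary Groups in Three Variables*, §1.10; [MoeglinWaldspurger1995] C. Mœglin, J.-L. Waldspurger, *Spectral Decomposition and Eisenstein Series*,
I.2.1, I.2.6, II.1.7; [WeilIntegration1965] A. Weil, *L'intégration dans les groupes topologiques*, §9; [DeitmarEchterhoff2014] A. Deitmar, S. Echterhoff, *Principles of Harmonic
Analysis*, Thm. 9.1.6.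
-/

set_option autoImplicit false
-- the mandated namespace repeats `HodgeConjecture.HodgeConjecture`, as in every `Theorems/*.lean` of this sub-problem
set_option linter.dupNamespace false

noncomputable section

open MeasureTheory MeasureTheory.Measure Set NumberField Filter Topology
open scoped NNReal ENNReal
open Literature.MeasureTheory.Group Literature.NumberTheory.Automorphic Literature.NumberTheory.Automorphic.UnitaryGroup AdelicGroupData
open Summit.HodgeConjecture.HodgeConjecture.Cruxes.H413.K2E1BLBorelSpacesU2Defs
open Summit.HodgeConjecture.HodgeConjecture.Cruxes.H413.K2E1BLQuotientMeasureU (measurePreserving_rightShift_of_unfolding)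
open Summit.HodgeConjecture.HodgeConjecture.Cruxes.H413.K2E1BLFibreAverageInvarianceU (integral_zFun_borelConstantTerm_eq_of_unfolding)
open Summit.HodgeConjecture.HodgeConjecture.Cruxes.H413.K2E1IntertwinedSectionInvariance (map_conj_toAdelic_eq_self_two)
open Summit.HodgeConjecture.HodgeConjecture.Cruxes.H413.K2E1HeisenbergHaarU3 (locallyCompactSpace_and_secondCountableTopology_adelicUnipotent)
open Summit.HodgeConjecture.HodgeConjecture.Cruxes.H413.K2E1SphericalEisensteinStructuralDataCMThree (exists_coveringWeight_unfoldedMeasure)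

namespace Summit.HodgeConjecture.HodgeConjecture.Cruxes.H413.K2E1SphericalEisensteinStructuralDataCMTwo

variable (L : Type) [Field L] [NumberField L] [IsCMField L]
  [MeasurableSpace (quasiSplit (↥(maximalRealSubfield L)) L (IsCMField.complexConj L) 2).Adelic] [BorelSpace (quasiSplit (↥(maximalRealSubfield L)) L (IsCMField.complexConj L) 2).Adelic]

/-! ## §1 The radical `N(𝔸) ≅ 𝔸_L⁻`: Haar measure and Tate's transported fundamental domain -/

/-- **THE RADICAL PACKAGE OF `U(1,1)_{L∕L⁺}` IS INHABITED**: there are a Haar measure `ν` on `N(𝔸)` which is right-invariant (`N(𝔸) ≅ 𝔸_L⁻` is abelian, ★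
`isMulRightInvariant_of_isMulLeftInvariant_two`) and inversion-invariant (★ `isInvInvariant_of_isMulRightInvariant`), and a fundamental domain `𝓕 = n(θ 𝓕⁻)` of `N(F)` in `N(𝔸)` (Tate,
★ `isFundamentalDomain_image_traceZeroFundamentalDomain_two`) with compact closure (★ `exists_isCompact_image_traceZeroFundamentalDomain_subset_two`) and `0 < ν 𝓕 < ∞` — the binders
`(ν) [IsHaarMeasure] [IsMulRightInvariant] [IsInvInvariant] (h𝓕N) (h𝓕c) (h𝓕₀)` of the closer ★ `sphericalEisenstein_meromorphic_cm_two_of_hK1`. [cite: CasselsFrohlichANT1967, Ch. XV Thm. 4.1.3]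
[cite: Rogawski1990, §1.10] [cite: MoeglinWaldspurger1995, I.2.1] -/
theorem exists_unipotent_haar_fundamentalDomain_cm_two :
    ∃ (ν : Measure ↥(adelicUnipotent (↥(maximalRealSubfield L)) L (IsCMField.complexConj L) 2))
      (𝓕 : Set ↥(adelicUnipotent (↥(maximalRealSubfield L)) L (IsCMField.complexConj L) 2)),
      ν.IsHaarMeasure ∧ ν.IsMulRightInvariant ∧ ν.IsInvInvariant ∧
      IsFundamentalDomain ↥(rationalUnipotent (↥(maximalRealSubfield L)) L (IsCMField.complexConj L) 2) 𝓕 ν ∧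
      IsCompact (closure 𝓕) ∧ ν 𝓕 ≠ 0 ∧ ν 𝓕 ≠ ∞ := by
  have hc : IsCMField.complexConj L * IsCMField.complexConj L = 1 := AlgEquiv.ext fun x => IsCMField.complexConj_apply_apply L x
  have hij : (((0 : Fin 2) : Fin 2) : ℕ) + 1 = (((1 : Fin 2) : Fin 2) : ℕ) := rfl
  have hN : 2 = 2 * (((0 : Fin 2) : Fin 2) : ℕ) + 2 := rfl
  haveI := t2Space_adeleRing_of_numberField L
  haveI : T2Space (quasiSplit (↥(maximalRealSubfield L)) L (IsCMField.complexConj L) 2).Adelic :=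
    inferInstanceAs (T2Space (adelic (↥(maximalRealSubfield L)) L (IsCMField.complexConj L) 2 ((StdForm.antidiagonal 2).over L)))
  obtain ⟨h₁, h₂⟩ := locallyCompactSpace_and_secondCountableTopology_adelicUnipotent (F := ↥(maximalRealSubfield L)) (E := L) (c := IsCMField.complexConj L) (N := 2)
  haveI := h₁
  haveI := h₂
  letI : MeasurableSpace (AdeleRing (𝓞 L) L) := borel _
  haveI : BorelSpace (AdeleRing (𝓞 L) L) := ⟨rfl⟩
  haveI : (haar : Measure ↥(adelicUnipotent (↥(maximalRealSubfield L)) L (IsCMField.complexConj L) 2)).IsMulRightInvariant :=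
    isMulRightInvariant_of_isMulLeftInvariant_two _
  have h𝓕N := isFundamentalDomain_image_traceZeroFundamentalDomain_two (F := ↥(maximalRealSubfield L)) (E := L) (c := IsCMField.complexConj L) hij hN hc
    (haar : Measure ↥(adelicUnipotent (↥(maximalRealSubfield L)) L (IsCMField.complexConj L) 2))
  obtain ⟨C, hC, hsub⟩ := exists_isCompact_image_traceZeroFundamentalDomain_subset_two (F := ↥(maximalRealSubfield L)) (E := L) (c := IsCMField.complexConj L) hij hN hc
  exact ⟨haar, _, inferInstance, inferInstance, isInvInvariant_of_isMulRightInvariant _, h𝓕N, hC.closure_of_subset hsub,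
    measure_ne_zero_of_isFundamentalDomain_rationalUnipotent _ h𝓕N, ((measure_mono hsub).trans_lt hC.measure_lt_top).ne⟩

/-! ## §2 The `G`-side: unimodularity of `U(J₂)(𝔸)`, a Haar measure with a covering weight and an s-finite unfolded measure -/

/-- **EVERY HAAR MEASURE OF `U(J₂)(𝔸_{L⁺})` IS RIGHT-INVARIANT** (★ `forall_isHaarMeasure_isMulRightInvariant_quasiSplit_cm`). [cite: MoeglinWaldspurger1995, I.2.1]
[cite: DeitmarEchterhoff2014, Thm. 9.1.6] -/
theorem isMulRightInvariant_of_isHaarMeasure_cm_two (νG : Measure (quasiSplit (↥(maximalRealSubfield L)) L (IsCMField.complexConj L) 2).Adelic) [νG.IsHaarMeasure] :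
    νG.IsMulRightInvariant :=
  forall_isHaarMeasure_isMulRightInvariant_quasiSplit_cm L le_rfl νG inferInstance

/-- **EVERY HAAR MEASURE OF `U(J₂)(𝔸_{L⁺})` IS INVERSION-INVARIANT** (unimodular ⇒ `ν_G(A⁻¹) = ν_G(A)`, ★ `isInvInvariant_of_isMulRightInvariant`). [cite: DeitmarEchterhoff2014, Thm. 9.1.6]
[cite: MoeglinWaldspurger1995, I.2.1] -/
theorem isInvInvariant_of_isHaarMeasure_cm_two (νG : Measure (quasiSplit (↥(maximalRealSubfield L)) L (IsCMField.complexConj L) 2).Adelic) [νG.IsHaarMeasure] :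
    νG.IsInvInvariant := by
  haveI := t2Space_adeleRing_of_numberField L
  haveI := locallyCompactSpace_adeleRing' L
  haveI := secondCountableTopology_adeleRing L
  haveI : LocallyCompactSpace (quasiSplit (↥(maximalRealSubfield L)) L (IsCMField.complexConj L) 2).Adelic :=
    inferInstanceAs (LocallyCompactSpace (adelic (↥(maximalRealSubfield L)) L (IsCMField.complexConj L) 2 ((StdForm.antidiagonal 2).over L)))
  haveI : SecondCountableTopology (quasiSplit (↥(maximalRealSubfield L)) L (IsCMField.complexConj L) 2).Adelic :=
    inferInstanceAs (SecondCountableTopology (adelic (↥(maximalRealSubfield L)) L (IsCMField.complexConj L) 2 ((StdForm.antidiagonal 2).over L)))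
  haveI := isMulRightInvariant_of_isHaarMeasure_cm_two L νG
  exact isInvInvariant_of_isMulRightInvariant νG

/-- **THE `G`-SIDE STRUCTURAL LETTERS ARE JOINTLY INHABITED AT `U(1,1)_{L∕L⁺}`**: a Haar measure `νG` of `G(𝔸)` (right- and inversion-invariant, s-finite), a covering weight `β`
of `B(F)♯` and an s-finite `μZ` on `Z = B(F)∖G(𝔸)` with the unfolding identity `hμZ` (★ every-rank `exists_coveringWeight_unfoldedMeasure`). [cite: WeilIntegration1965, §9]
[cite: MoeglinWaldspurger1995, I.2.1] -/
theorem exists_haar_coveringWeight_unfoldedMeasure_cm_two :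
    ∃ (νG : Measure (quasiSplit (↥(maximalRealSubfield L)) L (IsCMField.complexConj L) 2).Adelic)
      (β : (quasiSplit (↥(maximalRealSubfield L)) L (IsCMField.complexConj L) 2).Adelic → ℝ≥0∞)
      (μZ : Measure (borelQuotient (↥(maximalRealSubfield L)) L (IsCMField.complexConj L) 2)),
      νG.IsHaarMeasure ∧ νG.IsMulRightInvariant ∧ νG.IsInvInvariant ∧ SFinite νG ∧
      IsCoveringWeight ↥((arithmeticBorel (↥(maximalRealSubfield L)) L (IsCMField.complexConj L) 2).map
        (quasiSplit (↥(maximalRealSubfield L)) L (IsCMField.complexConj L) 2).arithmeticSubgroup.subtype) β ∧ SFinite μZ ∧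
      ∀ f : borelQuotient (↥(maximalRealSubfield L)) L (IsCMField.complexConj L) 2 → ℝ≥0∞, Measurable f →
        ∫⁻ z, f z ∂μZ = ∫⁻ g, β g * f (toBorelQuotient (↥(maximalRealSubfield L)) L (IsCMField.complexConj L) 2 g) ∂νG := by
  haveI := t2Space_adeleRing_of_numberField L
  haveI := locallyCompactSpace_adeleRing' L
  haveI := secondCountableTopology_adeleRing L
  haveI : LocallyCompactSpace (quasiSplit (↥(maximalRealSubfield L)) L (IsCMField.complexConj L) 2).Adelic :=
    inferInstanceAs (LocallyCompactSpace (adelic (↥(maximalRealSubfield L)) L (IsCMField.complexConj L) 2 ((StdForm.antidiagonal 2).over L)))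
  haveI : SecondCountableTopology (quasiSplit (↥(maximalRealSubfield L)) L (IsCMField.complexConj L) 2).Adelic :=
    inferInstanceAs (SecondCountableTopology (adelic (↥(maximalRealSubfield L)) L (IsCMField.complexConj L) 2 ((StdForm.antidiagonal 2).over L)))
  haveI : (haar : Measure (quasiSplit (↥(maximalRealSubfield L)) L (IsCMField.complexConj L) 2).Adelic).IsMulRightInvariant :=
    isMulRightInvariant_of_isHaarMeasure_cm_two L haar
  haveI : (haar : Measure (quasiSplit (↥(maximalRealSubfield L)) L (IsCMField.complexConj L) 2).Adelic).IsInvInvariant :=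
    isInvInvariant_of_isHaarMeasure_cm_two L haar
  obtain ⟨β, μZ, hβ, hsf, hμZ⟩ := exists_coveringWeight_unfoldedMeasure (haar : Measure (quasiSplit (↥(maximalRealSubfield L)) L (IsCMField.complexConj L) 2).Adelic)
  exact ⟨haar, β, μZ, inferInstance, inferInstance, inferInstance, inferInstance, hβ, hsf, hμZ⟩

/-! ## §3 The disintegration letter `hdis'` at `N = 2` -/

/-- **THE DISINTEGRATION LETTER `hdis'` OF THE `U(1,1)` CLOSER IS A THEOREM** (every weight `k` and level `a`; ★ p859271 proves it inline at `(n+3, a)`): for Borel left-`B(F)`-invariant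
`Φ` with `zFun Φ`, `zFun Φ_B` integrable w.r.t. `wtm_{k,a} μZ`, `∫_Z zFun Φ_B d(wtm) = ∫_Z zFun Φ d(wtm)` — ★ every-rank `integral_zFun_borelConstantTerm_eq_of_unfolding` with its conjugation letter
`hconj` discharged by the product formula ★ `map_conj_toAdelic_eq_self_two`. [cite: BernsteinLapid2019, §4 Claim 4 (p. 10)] [cite: MoeglinWaldspurger1995, II.1.7 and I.2.6] -/
theorem integral_zFun_borelConstantTerm_eq_cm_two
    (νG : Measure (quasiSplit (↥(maximalRealSubfield L)) L (IsCMField.complexConj L) 2).Adelic) [νG.IsHaarMeasure]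
    (ν : Measure ↥(adelicUnipotent (↥(maximalRealSubfield L)) L (IsCMField.complexConj L) 2)) [ν.IsHaarMeasure] [ν.IsInvInvariant]
    {𝓕 : Set ↥(adelicUnipotent (↥(maximalRealSubfield L)) L (IsCMField.complexConj L) 2)}
    (h𝓕N : IsFundamentalDomain ↥(rationalUnipotent (↥(maximalRealSubfield L)) L (IsCMField.complexConj L) 2) 𝓕 ν) (h𝓕₀ : ν 𝓕 ≠ 0) (h𝓕top : ν 𝓕 ≠ ∞)
    {β : (quasiSplit (↥(maximalRealSubfield L)) L (IsCMField.complexConj L) 2).Adelic → ℝ≥0∞}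
    (hβ : IsCoveringWeight ↥((arithmeticBorel (↥(maximalRealSubfield L)) L (IsCMField.complexConj L) 2).map
      (quasiSplit (↥(maximalRealSubfield L)) L (IsCMField.complexConj L) 2).arithmeticSubgroup.subtype) β)
    {μZ : Measure (borelQuotient (↥(maximalRealSubfield L)) L (IsCMField.complexConj L) 2)}
    (hμZ : ∀ f : borelQuotient (↥(maximalRealSubfield L)) L (IsCMField.complexConj L) 2 → ℝ≥0∞, Measurable f →
      ∫⁻ z, f z ∂μZ = ∫⁻ g, β g * f (toBorelQuotient (↥(maximalRealSubfield L)) L (IsCMField.complexConj L) 2 g) ∂νG)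
    (k : ℕ) (a : ℝ≥0) :
    ∀ Φ : (quasiSplit (↥(maximalRealSubfield L)) L (IsCMField.complexConj L) 2).Adelic → ℂ, Measurable Φ →
      (∀ b ∈ ratBorelSubgroup (↥(maximalRealSubfield L)) L (IsCMField.complexConj L) 2, ∀ g, Φ (b * g) = Φ g) →
      Integrable (zFun (↥(maximalRealSubfield L)) L (IsCMField.complexConj L) 2 Φ) (weightedTruncMeasure (↥(maximalRealSubfield L)) L (IsCMField.complexConj L) 2 k a μZ) →
      Integrable (zFun (↥(maximalRealSubfield L)) L (IsCMField.complexConj L) 2 (borelConstantTerm ν 𝓕 Φ)) (weightedTruncMeasure (↥(maximalRealSubfield L)) L (IsCMField.complexConj L) 2 k a μZ) →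
        ∫ x, zFun (↥(maximalRealSubfield L)) L (IsCMField.complexConj L) 2 (borelConstantTerm ν 𝓕 Φ) x ∂(weightedTruncMeasure (↥(maximalRealSubfield L)) L (IsCMField.complexConj L) 2 k a μZ) =
          ∫ x, zFun (↥(maximalRealSubfield L)) L (IsCMField.complexConj L) 2 Φ x ∂(weightedTruncMeasure (↥(maximalRealSubfield L)) L (IsCMField.complexConj L) 2 k a μZ) := by
  have hc : IsCMField.complexConj L * IsCMField.complexConj L = 1 := AlgEquiv.ext fun x => IsCMField.complexConj_apply_apply L x
  have hc1 : IsCMField.complexConj L ≠ 1 := IsCMField.complexConj_ne_one L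
  intro Φ hΦm hΦB hint hint'
  exact integral_zFun_borelConstantTerm_eq_of_unfolding νG ν (fun _ hb₀ => map_conj_toAdelic_eq_self_two hc hc1 ν hb₀) h𝓕N h𝓕₀ h𝓕top hβ hμZ k a hΦm hΦB hint hint'

/-- **`hdis'` AT `U(1,1)_{L∕L⁺}` FROM THE CLOSER'S BINDERS `(h𝓕N) (h𝓕c : IsCompact (closure 𝓕))`**: `0 < ν 𝓕` for every fundamental domain of `N(F)` (★
`measure_ne_zero_of_isFundamentalDomain_rationalUnipotent`) and `ν 𝓕 ≤ ν (closure 𝓕) < ∞`; then §3. [cite: BernsteinLapid2019, §4 Claim 4 (p. 10)] [cite: CasselsFrohlichANT1967, Ch. XV Thm. 4.1.3] -/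
theorem integral_zFun_borelConstantTerm_eq_of_isCompact_closure_cm_two
    (νG : Measure (quasiSplit (↥(maximalRealSubfield L)) L (IsCMField.complexConj L) 2).Adelic) [νG.IsHaarMeasure]
    (ν : Measure ↥(adelicUnipotent (↥(maximalRealSubfield L)) L (IsCMField.complexConj L) 2)) [ν.IsHaarMeasure] [ν.IsInvInvariant]
    {𝓕 : Set ↥(adelicUnipotent (↥(maximalRealSubfield L)) L (IsCMField.complexConj L) 2)}
    (h𝓕N : IsFundamentalDomain ↥(rationalUnipotent (↥(maximalRealSubfield L)) L (IsCMField.complexConj L) 2) 𝓕 ν) (h𝓕c : IsCompact (closure 𝓕))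
    {β : (quasiSplit (↥(maximalRealSubfield L)) L (IsCMField.complexConj L) 2).Adelic → ℝ≥0∞}
    (hβ : IsCoveringWeight ↥((arithmeticBorel (↥(maximalRealSubfield L)) L (IsCMField.complexConj L) 2).map
      (quasiSplit (↥(maximalRealSubfield L)) L (IsCMField.complexConj L) 2).arithmeticSubgroup.subtype) β)
    {μZ : Measure (borelQuotient (↥(maximalRealSubfield L)) L (IsCMField.complexConj L) 2)}
    (hμZ : ∀ f : borelQuotient (↥(maximalRealSubfield L)) L (IsCMField.complexConj L) 2 → ℝ≥0∞, Measurable f →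
      ∫⁻ z, f z ∂μZ = ∫⁻ g, β g * f (toBorelQuotient (↥(maximalRealSubfield L)) L (IsCMField.complexConj L) 2 g) ∂νG)
    (k : ℕ) (a : ℝ≥0) :
    ∀ Φ : (quasiSplit (↥(maximalRealSubfield L)) L (IsCMField.complexConj L) 2).Adelic → ℂ, Measurable Φ →
      (∀ b ∈ ratBorelSubgroup (↥(maximalRealSubfield L)) L (IsCMField.complexConj L) 2, ∀ g, Φ (b * g) = Φ g) →
      Integrable (zFun (↥(maximalRealSubfield L)) L (IsCMField.complexConj L) 2 Φ) (weightedTruncMeasure (↥(maximalRealSubfield L)) L (IsCMField.complexConj L) 2 k a μZ) →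
      Integrable (zFun (↥(maximalRealSubfield L)) L (IsCMField.complexConj L) 2 (borelConstantTerm ν 𝓕 Φ)) (weightedTruncMeasure (↥(maximalRealSubfield L)) L (IsCMField.complexConj L) 2 k a μZ) →
        ∫ x, zFun (↥(maximalRealSubfield L)) L (IsCMField.complexConj L) 2 (borelConstantTerm ν 𝓕 Φ) x ∂(weightedTruncMeasure (↥(maximalRealSubfield L)) L (IsCMField.complexConj L) 2 k a μZ) =
          ∫ x, zFun (↥(maximalRealSubfield L)) L (IsCMField.complexConj L) 2 Φ x ∂(weightedTruncMeasure (↥(maximalRealSubfield L)) L (IsCMField.complexConj L) 2 k a μZ) :=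
  integral_zFun_borelConstantTerm_eq_cm_two L νG ν h𝓕N (measure_ne_zero_of_isFundamentalDomain_rationalUnipotent _ h𝓕N)
    ((measure_mono subset_closure).trans_lt h𝓕c.measure_lt_top).ne hβ hμZ k a

/-! ## §4 Right-invariance of `μZ` at `N = 2` -/

/-- **`μZ` IS RIGHT-INVARIANT AT `U(1,1)_{L∕L⁺}`** (the closer's `hright`, ★ p859271 :122): ★ every-rank `measurePreserving_rightShift_of_unfolding` with the right-invariance of the Haar
measure `ν_G` discharged by unimodularity (§2). [cite: BernsteinLapid2019, §4 (p. 10)] [cite: WeilIntegration1965, §9] -/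
theorem measurePreserving_rightShift_cm_two
    (νG : Measure (quasiSplit (↥(maximalRealSubfield L)) L (IsCMField.complexConj L) 2).Adelic) [νG.IsHaarMeasure]
    {β : (quasiSplit (↥(maximalRealSubfield L)) L (IsCMField.complexConj L) 2).Adelic → ℝ≥0∞}
    (hβ : IsCoveringWeight ↥((arithmeticBorel (↥(maximalRealSubfield L)) L (IsCMField.complexConj L) 2).map
      (quasiSplit (↥(maximalRealSubfield L)) L (IsCMField.complexConj L) 2).arithmeticSubgroup.subtype) β)
    {μZ : Measure (borelQuotient (↥(maximalRealSubfield L)) L (IsCMField.complexConj L) 2)}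
    (hμZ : ∀ f : borelQuotient (↥(maximalRealSubfield L)) L (IsCMField.complexConj L) 2 → ℝ≥0∞, Measurable f →
      ∫⁻ z, f z ∂μZ = ∫⁻ g, β g * f (toBorelQuotient (↥(maximalRealSubfield L)) L (IsCMField.complexConj L) 2 g) ∂νG)
    (y : (quasiSplit (↥(maximalRealSubfield L)) L (IsCMField.complexConj L) 2).Adelic) :
    MeasurePreserving (rightShift (↥(maximalRealSubfield L)) L (IsCMField.complexConj L) 2 y) μZ μZ := by
  haveI := isMulRightInvariant_of_isHaarMeasure_cm_two L νG
  exact measurePreserving_rightShift_of_unfolding νG hβ hμZ y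

end Summit.HodgeConjecture.HodgeConjecture.Cruxes.H413.K2E1SphericalEisensteinStructuralDataCMTwo

end
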